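/-
Copyright (c) 2026 the pub-hodgecm-mathlib formalisation cell (harness21).  Prover seat hodgecm-mathlib-LH4-p12 (g0), Track A «FOUR-FRAME», unit U2H_HSide, (ρ)-child (b′),
dictionary first seat (LH4-p13 (g0) handoff 23:23:30Z): the (e₀)-TWIN CAPSTONE for the TYPE-(1) population.  2026-09-03.
-/
import Summits.HodgeConjecture.HodgeConjecture.Theorems.F0P3cDyRamHProfilesTypeOnePartner     -- ★ (this seat): (b′-4) `Φ^st(γ_H, hFamily s) = ν_H(C_s × U₁)·(2·#Fix_{γ₂}(U₂ ⧸ C_s))` on the type-(1) population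
import Literature.NumberTheory.Automorphic.SLTwoTreeFixedSubtreeCount                       -- ★ (LH4-p13): fixed-subtree ∕ torus-form EDGE counts; brings ★ p855177 p855231 p855331 p847070 p855257
import HarnessLib

/-!
# Crux `H413`, line LH4 «(D-RAM) FOUR-FRAME», unit U2H (ii-H), child (b′) «ROW (1) H-SIDE DEPTH IDENTITY» — THE H-SIDE OF THE TYPE-(1) ROW IN TORUS-FORM TOKENS AT A
# WILD (OR TAME) RAMIFIED PLACE: `Φ^st(γ_H, hFamily s) = ν_H(C_s × U₁) · 2N_s` with the EXACT ℕ-law of `N_s` — Eisenstein `(q − 1)·N + 2 = 2·q^{n+1}` on the vertex column,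
# `N ↦ N + 1` on the edge column (√u: `s = 1`; √π: `s = 0`) — NO `|2|_w = 1`

Cell `hodgecm-mathlib` (D-0151), FLOOR 0, crux item H413 = `stmt-HodgeConjecture-24833`, route of record `HCCMUnconditional`; squad F0∕P3c∕LH4.  THEOREMS ONLY (no `def`, no
instance, no notation, no named fact, no `sorry`, default heartbeats); kernel lane `--supports stmt-HodgeConjecture-24833 --as helper` (count-neutral).  This is the TYPE-(1) twin
of LH4-p13 (g0)'s ★ p855511 `F0P3cDyRamHSideTypeTwoTorusForm` (the (e₀) capstone of the type-(2) row): same descent, same tree counts, with the two differences of type (1) —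
(i) the stable class has TWO `U₂`-classes, whose fixed-coset counts agree (★ (b′-4) `F0P3cDyRamHProfilesTypeOnePartner`, the ramified unit-similitude partner), whence the
factor `2`; (ii) the eigen-field of the descent representative is `L_w` itself, so ONLY the EISENSTEIN datum of `L_w ∕ L⁺_v` occurs (no inert column).

WHAT IS PROVED (4 theorems = 2 profiles × 2 place types).  Let `w ∣ v` be a ramified non-split CM place (`he`), `α` anti-fixed with `|α|_w = 1` (√u-type: wild, `d` even) or
`|α|_w = |ϖ_w|` (√π-type: tame, or wild with `d` odd), `γ_H = (γ₂, γ₁) ∈ H_v = U₂ × U₁` `G`-regular of TYPE (1) — the characteristic polynomial of `γ₂` at `w` HAS a root in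
`L_w` (`hsplit`) and `γ_H` is not `H_v`-conjugate into the diagonal torus (`hell`, ★ p855564 from norm-one distinct roots) — and `g ∈ GL₂(L⁺_v)` a descent representative of
`E₂γ₂` (`diag(1, α)·E₂γ₂·diag(1, α)⁻¹ = s·g`, ★ `exists_descent_of_antiFixed`) which is conjugate UP TO A SCALAR to a unit `γ₁ = (a, bv; b, a + bu)` (`|b| = |ϖ|ⁿ`) of the
EISENSTEIN order `𝒪[τ]`, `τ² = uτ + v` (`|u| < 1`, `|v| = |ϖ|`; binders from ★ p855546 §3 ∕ ★ p855714 `exists_torusForm_binders_of_eisenstein_of_deep'`).  Then, with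
`q = #𝓀(L⁺_v)` and `ν_H` the Haar measure of the canonical family:
* `s = 0` (`hFamily 0 = 1_{K₂ × U₁}`): `Φ^st(γ_H, hFamily 0) = ν_H(K₂ × U₁)·2N`, where √u: `(q − 1)·N + 2 = 2·q^{n+1}` — `K₂` ↔ fixed VERTICES (★ p855177); √π:
  `(q − 1)·(N + 1) + 2 = 2·q^{n+1}` — `K₂` ↔ set-wise fixed EDGES (★ p855331), one fewer than the vertices of the fixed subtree (★ `SLTwoTreeFixedSubtreeCount`).
* `s = 1` (`hFamily 1 = 1_{K♯ × U₁}`, `K♯` any compact open subgroup matched with `D_ϖ GL₂(𝒪_w) D_ϖ⁻¹` — ★ (b′-4) `exists_stableOrbitalIntegralRel_hFamily_one_typeOne` provides one):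
  the same with the roles of vertices and edges exchanged (√u: `K♯` ↔ edges ★ p855231; √π: `K♯` ↔ vertices ★ p847070 §1 + ★ `natCard_fixedBy_eq_ncard_fixedBy_onePlace`).
The vertex counts are ★ p855257 (`SLTwoTreeEllipticFixedBallTorusForm`, any residue characteristic).  The census depth `n` is tied to the ROW DEPTH `n₃ = v_w(e₁ − e₂)` by ★ p855609
`F0P3cDyRamTypeOneDepthLaw.depth_eq_two_mul_add` (`n₃ = 2n + d`, so the (b′) radius `(n₃ + 2 − d)∕2 = n + 1`), and the torus-form binders exist in vertex type exactly when `n₃ ≥ d`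
(★ p855714 (N2′)).  The statements are EXISTENTIAL IN `N` with an exact ℕ-identity, so the row assembler (★ p855670, LH4-p08 (g2)) casts once.

WHAT IS NOT CLAIMED.  The descent datum of a given row element (which `g`, `(u, v)`, `n`) is supplied by the assembler from ★ `exists_descent_of_antiFixed` ∕ ★ p855618 ∕ ★ p855714 ∕
★ p855609; nothing printed is asserted; HONEST LABEL: `HC_CM` is proved only modulo the 7 printed citations (2 remaining named inputs: hLiu418 = `stmt-HodgeConjecture-24832`,
h413 = `stmt-HodgeConjecture-24833`) until rung 0 closes.

## References
* [Rogawski1990] J. D. Rogawski, *Automorphic representations of unitary groups in three variables* (1990), §4.9 Prop. 4.9.1 (b) p. 55, Lemma 4.9.3 p. 56 (the `H`-side terms);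
  §3.6 pp. 31–32 (two classes in a stable elliptic class).
* [Kottwitz1988] R. E. Kottwitz, *Tamagawa numbers*, Ann. of Math. 127 (1988), §2 (orbital integrals of indicators as fixed-coset counts; fixed subtrees).
* [LabesseLanglands1979] J.-P. Labesse, R. P. Langlands, *L-indistinguishability for SL(2)*, Canad. J. Math. 31 (1979), §2 p. 8 (fixed balls of elliptic tori).
* [Tits1979] J. Tits, *Reductive groups over local fields*, PSPM 33.1 (1979), §3.2 p. 50 (vertex stabilisers of quasi-split `U(2)`).
* [Serre1979] J.-P. Serre, *Local Fields*, GTM 67 (1979), Ch. I §6 (Eisenstein equations).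
-/

set_option autoImplicit false

noncomputable section

namespace Summit.HodgeConjecture.HodgeConjecture.Cruxes.H413.F0P3cDyRamHSideTypeOneTorusForm

open MeasureTheory Measure NumberField IsDedekindDomain Topology Filter MulAction Matrix WithZero ValuativeRel
open Literature.NumberTheory.Automorphic Literature.NumberTheory.Automorphic.UnitaryGroup Literature.NumberTheory.Automorphic.IntegralReduction
open Literature.NumberTheory.Automorphic.HermitianLatticeTree
open Literature.NumberTheory.Rogawski1990 Literature.NumberTheory.GaloisRepresentations
open Summit.HodgeConjecture.HodgeConjecture.Cruxes.H413.F0P3cDyRamFourFrameHFamilyDefs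
open Summit.HodgeConjecture.HodgeConjecture.Cruxes.H413.F0P3cDyRamHProfilesTypeTwoUnfolding
open Summit.HodgeConjecture.HodgeConjecture.Cruxes.H413.F0P3cDyRamHProfilesTypeOnePartner
open scoped Matrix MatrixGroups WithZero ValuativeRel

section Place

variable (L : Type) [Field L] [NumberField L] [IsCMField L] (v : HeightOneSpectrum (𝓞 ↥(maximalRealSubfield L)))
  (w : PlacesOver L v) (hw : IsCMField.complexConj L • w.1 = w.1)
  {α : w.1.adicCompletion L} (hα : galAdicCompletionMap (L := L) (IsCMField.complexConj L) hw α = -α) (hα0 : α ≠ 0)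
  {ϖF : v.adicCompletion ↥(maximalRealSubfield L)} (hϖF : Valued.v ϖF = exp (-1 : ℤ))
  [Finite (IsLocalRing.ResidueField 𝒪[v.adicCompletion ↥(maximalRealSubfield L)])]
  [MeasurableSpace ((cmDatum L 2 (Matrix.of fun i j : Fin 2 => if i.val + j.val + 1 = 2 then (1 : L) else 0)).Local v × (cmDatum L 1 (Matrix.of fun i j : Fin 1 => if i.val + j.val + 1 = 1 then (1 : L) else 0)).Local v)] [BorelSpace ((cmDatum L 2 (Matrix.of fun i j : Fin 2 => if i.val + j.val + 1 = 2 then (1 : L) else 0)).Local v × (cmDatum L 1 (Matrix.of fun i j : Fin 1 => if i.val + j.val + 1 = 1 then (1 : L) else 0)).Local v)]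
  [∀ a : ((cmDatum L 2 (Matrix.of fun i j : Fin 2 => if i.val + j.val + 1 = 2 then (1 : L) else 0)).Local v × (cmDatum L 1 (Matrix.of fun i j : Fin 1 => if i.val + j.val + 1 = 1 then (1 : L) else 0)).Local v), MeasurableSpace (((cmDatum L 2 (Matrix.of fun i j : Fin 2 => if i.val + j.val + 1 = 2 then (1 : L) else 0)).Local v × (cmDatum L 1 (Matrix.of fun i j : Fin 1 => if i.val + j.val + 1 = 1 then (1 : L) else 0)).Local v) ⧸ Subgroup.centralizer ({a} : Set ((cmDatum L 2 (Matrix.of fun i j : Fin 2 => if i.val + j.val + 1 = 2 then (1 : L) else 0)).Local v × (cmDatum L 1 (Matrix.of fun i j : Fin 1 => if i.val + j.val + 1 = 1 then (1 : L) else 0)).Local v)))]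
  [∀ a : ((cmDatum L 2 (Matrix.of fun i j : Fin 2 => if i.val + j.val + 1 = 2 then (1 : L) else 0)).Local v × (cmDatum L 1 (Matrix.of fun i j : Fin 1 => if i.val + j.val + 1 = 1 then (1 : L) else 0)).Local v), BorelSpace (((cmDatum L 2 (Matrix.of fun i j : Fin 2 => if i.val + j.val + 1 = 2 then (1 : L) else 0)).Local v × (cmDatum L 1 (Matrix.of fun i j : Fin 1 => if i.val + j.val + 1 = 1 then (1 : L) else 0)).Local v) ⧸ Subgroup.centralizer ({a} : Set ((cmDatum L 2 (Matrix.of fun i j : Fin 2 => if i.val + j.val + 1 = 2 then (1 : L) else 0)).Local v × (cmDatum L 1 (Matrix.of fun i j : Fin 1 => if i.val + j.val + 1 = 1 then (1 : L) else 0)).Local v)))]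
  (νH : Measure ((cmDatum L 2 (Matrix.of fun i j : Fin 2 => if i.val + j.val + 1 = 2 then (1 : L) else 0)).Local v × (cmDatum L 1 (Matrix.of fun i j : Fin 1 => if i.val + j.val + 1 = 1 then (1 : L) else 0)).Local v)) [νH.IsHaarMeasure] [νH.IsMulRightInvariant]


/-! ## §1 √u-TYPE PLACES (`α` an anti-fixed UNIT — wild, `d` even): `K₂` ↔ fixed vertices, `K♯` ↔ set-wise fixed edges -/

include hw hα hα0 hϖF in
/-- **(b′) H-SIDE, `s = 0`, √u-TYPE PLACE, TYPE (1)**: `Φ^st(γ_H, hFamily 0) = ν_H(K₂ × U₁)·2N` with **`(q − 1)·N + 2 = 2·q^{n+1}`** — `γ_H = (γ₂, γ₁)` `G`-regular of type (1) (split at `w`, elliptic), `g` a descent representative of `E₂γ₂` conjugate up to a scalar to a unit `a + bτ` (`|b| = |ϖ|ⁿ`) of the EISENSTEIN order `𝒪[τ]`, `τ² = uτ + v` (`|u| < 1`, `|v| = |ϖ|`; the eigen-field of `g` is `L_w`).  ★ (b′-4) + ★ p855177 (`K₂` ↔ vertices) + ★ p855257 (vertex ball).  Any residue characteristic. [cite: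 Rogawski1990, §4.9 Prop. 4.9.1 (b) p. 55, Lemma 4.9.3 p. 56; §3.6 pp. 31–32] [cite: Kottwitz1988, §2] [cite: LabesseLanglands1979, §2 p. 8] [cite: Tits1979, §3.2 p. 50] [cite: Serre1979, Ch. I §6] -/
theorem exists_hFamily_zero_eq_mul_two_mul_and_law_of_v_eq_one (he : v.asIdeal.ramificationIdx' w.1.asIdeal ≠ 1) (hvα : Valued.v α = 1)
    (ϖ : w.1.adicCompletion L)
    {mH : OrbitalMeasureFamily ((cmDatum L 2 (Matrix.of fun i j : Fin 2 => if i.val + j.val + 1 = 2 then (1 : L) else 0)).Local v × (cmDatum L 1 (Matrix.of fun i j : Fin 1 => if i.val + j.val + 1 = 1 then (1 : L) else 0)).Local v)} (hmH : mH.IsCanonical (IsLocalGRegular L v) νH)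
    {γH : ((cmDatum L 2 (Matrix.of fun i j : Fin 2 => if i.val + j.val + 1 = 2 then (1 : L) else 0)).Local v × (cmDatum L 1 (Matrix.of fun i j : Fin 1 => if i.val + j.val + 1 = 1 then (1 : L) else 0)).Local v)} (hreg : IsLocalGRegular L v γH)
    (hsplit : ∃ x : (w.1.adicCompletion L), ((((γH.1.val : GL (Fin 2) (UnitaryGroup.LocalRing L v)).val.map (Pi.evalRingHom (fun w' : PlacesOver L v => w'.1.adicCompletion L) w))).charpoly).IsRoot x)
    (hell : ¬ ∃ (y : ((cmDatum L 2 (Matrix.of fun i j : Fin 2 => if i.val + j.val + 1 = 2 then (1 : L) else 0)).Local v × (cmDatum L 1 (Matrix.of fun i j : Fin 1 => if i.val + j.val + 1 = 1 then (1 : L) else 0)).Local v)) (d' : Fin 2 → (UnitaryGroup.LocalRing L v)ˣ),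
        glDiagonal 2 (UnitaryGroup.LocalRing L v) d' = ((y * γH * y⁻¹).1.val : GL (Fin 2) (UnitaryGroup.LocalRing L v)))
    -- the descent representative `g ∈ GL₂(L⁺_v)` of `E₂ γ₂` (★ `exists_descent_of_antiFixed`)
    {s : w.1.adicCompletion L} {g : GL (Fin 2) (v.adicCompletion ↥(maximalRealSubfield L))} (hs : s ≠ 0)
    (hsg : Matrix.diagonal ![1, α] * ((((localNonsplitEquiv (IsCMField.complexConj L) (Matrix.of fun i j : Fin 2 => if i.val + j.val + 1 = 2 then (1 : L) else 0) (IsCMField.complexConj_ne_one L) w hw) γH.1 : ↥(unitaryGroupOfForm (galAdicCompletionMap (L := L) (IsCMField.complexConj L) hw) (placeForm (Matrix.of fun i j : Fin 2 => if i.val + j.val + 1 = 2 then (1 : L) else 0) w.1))) : GL (Fin 2) (w.1.adicCompletion L)) : Matrix (Fin 2) (Fin 2) (w.1.adicCompletion L)) * Matrix.diagonal ![1, α⁻¹] =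
      s • (g : Matrix (Fin 2) (Fin 2) (v.adicCompletion ↥(maximalRealSubfield L))).map (toPlace v w))
    -- the EISENSTEIN torus datum of `g`: `|uτ| < 1`, `|vτ| = |ϖ|`; `h g h⁻¹ = c·γ₁`, `γ₁ = (a, b vτ; b, a + b uτ)` a unit of the Eisenstein order, `|b| = |ϖ|ⁿ`
    {uτ vτ : v.adicCompletion ↥(maximalRealSubfield L)} (hu : uτ ∈ 𝒪[v.adicCompletion ↥(maximalRealSubfield L)]) (hu1 : valuation (v.adicCompletion ↥(maximalRealSubfield L)) uτ < 1) (hv1 : valuation (v.adicCompletion ↥(maximalRealSubfield L)) vτ = valuation (v.adicCompletion ↥(maximalRealSubfield L)) ϖF)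
    {h γ₁ : GL (Fin 2) (v.adicCompletion ↥(maximalRealSubfield L))} {c a b : v.adicCompletion ↥(maximalRealSubfield L)} (hc : c ≠ 0)
    (hconj : ((h * g * h⁻¹ : GL (Fin 2) (v.adicCompletion ↥(maximalRealSubfield L))) : Matrix (Fin 2) (Fin 2) (v.adicCompletion ↥(maximalRealSubfield L))) = c • (γ₁ : Matrix (Fin 2) (Fin 2) (v.adicCompletion ↥(maximalRealSubfield L))))
    (hγ₁ : (γ₁ : Matrix (Fin 2) (Fin 2) (v.adicCompletion ↥(maximalRealSubfield L))) = !![a, b * vτ; b, a + b * uτ]) (ha : a ∈ 𝒪[v.adicCompletion ↥(maximalRealSubfield L)]) (hb : b ∈ 𝒪[v.adicCompletion ↥(maximalRealSubfield L)])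
    (hγ₁det : valuation (v.adicCompletion ↥(maximalRealSubfield L)) (γ₁ : Matrix (Fin 2) (Fin 2) (v.adicCompletion ↥(maximalRealSubfield L))).det = 1) {n : ℕ} (hbn : valuation (v.adicCompletion ↥(maximalRealSubfield L)) b = valuation (v.adicCompletion ↥(maximalRealSubfield L)) ϖF ^ n)
    (v₀ : {M : Submodule 𝒪[v.adicCompletion ↥(maximalRealSubfield L)] (Fin 2 → v.adicCompletion ↥(maximalRealSubfield L)) // IsSpecialLattice (RingHom.id _) ϖF !![(0 : v.adicCompletion ↥(maximalRealSubfield L)), 1; -1, 0] M}) (hv₀ : v₀.1 = latt (1 : Matrix (Fin 2) (Fin 2) (v.adicCompletion ↥(maximalRealSubfield L)))) :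
    ∃ N : ℕ, stableOrbitalIntegralRel (IsLocalStablyConjH L v) mH (hFamily L w hw ϖ 0) γH = (νH.real (((cmLocalIntegralLevel L 2 (Matrix.of fun i j : Fin 2 => if i.val + j.val + 1 = 2 then (1 : L) else 0) v).prod (⊤ : Subgroup ((cmDatum L 1 (Matrix.of fun i j : Fin 1 => if i.val + j.val + 1 = 1 then (1 : L) else 0)).Local v)) : Subgroup ((cmDatum L 2 (Matrix.of fun i j : Fin 2 => if i.val + j.val + 1 = 2 then (1 : L) else 0)).Local v × (cmDatum L 1 (Matrix.of fun i j : Fin 1 => if i.val + j.val + 1 = 1 then (1 : L) else 0)).Local v)) : Set ((cmDatum L 2 (Matrix.of fun i j : Fin 2 => if i.val + j.val + 1 = 2 then (1 : L) else 0)).Local v × (cmDatum L 1 (Matrix.of fun i j : Fin 1 => if i.val + j.val + 1 = 1 then (1 : L) else 0)).Local v)) : ℂ) * (2 * (N : ℂ)) ∧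
      (Nat.card (IsLocalRing.ResidueField 𝒪[v.adicCompletion ↥(maximalRealSubfield L)]) - 1) * N + 2 = 2 * Nat.card (IsLocalRing.ResidueField 𝒪[v.adicCompletion ↥(maximalRealSubfield L)]) ^ (n + 1) := by
  haveI : IsDiscreteValuationRing 𝒪[v.adicCompletion ↥(maximalRealSubfield L)] := isDiscreteValuationRing_integer_of_compatible hϖF
  refine ⟨_, stableOrbitalIntegralRel_hFamily_zero_typeOne L v w hw νH he ϖ hmH hreg hsplit hell, ?_⟩
  rw [natCard_fixedBy_cmLocalIntegralLevel_eq_ncard_setOf_glVertexAct_of_v_eq_one L v w hw hα hα0 hϖF he hvα γH.1 hs hsg]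
  exact ncard_setOf_glVertexAct_eq_self_of_eisenstein_torusForm (isUniformizingElement_of_v_eq hϖF) hu hu1 hv1 hc hconj hγ₁ ha hb hγ₁det hbn v₀ hv₀

include hw hα hα0 hϖF in
/-- **(b′) H-SIDE, `s = 1`, √u-TYPE PLACE, TYPE (1)**: for `K♯ ≤ U₂` matched with `D_ϖ GL₂(𝒪_w) D_ϖ⁻¹` (compact open), `Φ^st(γ_H, hFamily 1) = ν_H(K♯ × U₁)·2N` with **`(q − 1)·(N + 1) + 2 = 2·q^{n+1}`** — `K♯` ↔ set-wise fixed EDGES at a √u place (★ p855231), edges = vertices − 1 on the fixed subtree (★ `SLTwoTreeFixedSubtreeCount` §2); ★ (b′-4) `stableOrbitalIntegralRel_hFamily_one_typeOne`. [cite: Rogawski1990, §4.9 Prop. 4.9.1 (b) p. 55, Lemma 4.9.3 p. 56; §3.6 pp. 31–32] [cite: Kottwitz1988, §2] [cite: LabesseLanglands1979, §2 p. 8] [cite: Tits1979, §3.2 p. 50] [cite: Serre1979, Ch. I §6] -/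
theorem exists_hFamily_one_eq_mul_two_mul_and_law_of_v_eq_one (he : v.asIdeal.ramificationIdx' w.1.asIdeal ≠ 1) (hvα : Valued.v α = 1)
    (ϖ : (w.1.adicCompletion L)ˣ) (hϖ : Valued.v (ϖ : w.1.adicCompletion L) = exp (-1 : ℤ))
    (Ksh : Subgroup ((cmDatum L 2 (Matrix.of fun i j : Fin 2 => if i.val + j.val + 1 = 2 then (1 : L) else 0)).Local v)) (hKsh : ∀ g', g' ∈ Ksh ↔ (((localNonsplitEquiv (IsCMField.complexConj L) (Matrix.of fun i j : Fin 2 => if i.val + j.val + 1 = 2 then (1 : L) else 0) (IsCMField.complexConj_ne_one L) w hw) g' : ↥(unitaryGroupOfForm (galAdicCompletionMap (L := L) (IsCMField.complexConj L) hw) (placeForm (Matrix.of fun i j : Fin 2 => if i.val + j.val + 1 = 2 then (1 : L) else 0) w.1))) : GL (Fin 2) (w.1.adicCompletion L)) ∈ (glInt 2 (w.1.adicCompletion L)).map (MulAut.conj (glDiagonal 2 (w.1.adicCompletion L) ![1, ϖ])).toMonoidHom)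
    (hKo : IsOpen (Ksh : Set ((cmDatum L 2 (Matrix.of fun i j : Fin 2 => if i.val + j.val + 1 = 2 then (1 : L) else 0)).Local v))) (hKc : IsCompact (Ksh : Set ((cmDatum L 2 (Matrix.of fun i j : Fin 2 => if i.val + j.val + 1 = 2 then (1 : L) else 0)).Local v)))
    {mH : OrbitalMeasureFamily ((cmDatum L 2 (Matrix.of fun i j : Fin 2 => if i.val + j.val + 1 = 2 then (1 : L) else 0)).Local v × (cmDatum L 1 (Matrix.of fun i j : Fin 1 => if i.val + j.val + 1 = 1 then (1 : L) else 0)).Local v)} (hmH : mH.IsCanonical (IsLocalGRegular L v) νH)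
    {γH : ((cmDatum L 2 (Matrix.of fun i j : Fin 2 => if i.val + j.val + 1 = 2 then (1 : L) else 0)).Local v × (cmDatum L 1 (Matrix.of fun i j : Fin 1 => if i.val + j.val + 1 = 1 then (1 : L) else 0)).Local v)} (hreg : IsLocalGRegular L v γH)
    (hsplit : ∃ x : (w.1.adicCompletion L), ((((γH.1.val : GL (Fin 2) (UnitaryGroup.LocalRing L v)).val.map (Pi.evalRingHom (fun w' : PlacesOver L v => w'.1.adicCompletion L) w))).charpoly).IsRoot x)
    (hell : ¬ ∃ (y : ((cmDatum L 2 (Matrix.of fun i j : Fin 2 => if i.val + j.val + 1 = 2 then (1 : L) else 0)).Local v × (cmDatum L 1 (Matrix.of fun i j : Fin 1 => if i.val + j.val + 1 = 1 then (1 : L) else 0)).Local v)) (d' : Fin 2 → (UnitaryGroup.LocalRing L v)ˣ),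
        glDiagonal 2 (UnitaryGroup.LocalRing L v) d' = ((y * γH * y⁻¹).1.val : GL (Fin 2) (UnitaryGroup.LocalRing L v)))
    -- the descent representative `g ∈ GL₂(L⁺_v)` of `E₂ γ₂` (★ `exists_descent_of_antiFixed`)
    {s : w.1.adicCompletion L} {g : GL (Fin 2) (v.adicCompletion ↥(maximalRealSubfield L))} (hs : s ≠ 0)
    (hsg : Matrix.diagonal ![1, α] * ((((localNonsplitEquiv (IsCMField.complexConj L) (Matrix.of fun i j : Fin 2 => if i.val + j.val + 1 = 2 then (1 : L) else 0) (IsCMField.complexConj_ne_one L) w hw) γH.1 : ↥(unitaryGroupOfForm (galAdicCompletionMap (L := L) (IsCMField.complexConj L) hw) (placeForm (Matrix.of fun i j : Fin 2 => if i.val + j.val + 1 = 2 then (1 : L) else 0) w.1))) : GL (Fin 2) (w.1.adicCompletion L)) : Matrix (Fin 2) (Fin 2) (w.1.adicCompletion L)) * Matrix.diagonal ![1, α⁻¹] =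
      s • (g : Matrix (Fin 2) (Fin 2) (v.adicCompletion ↥(maximalRealSubfield L))).map (toPlace v w))
    -- the EISENSTEIN torus datum of `g`: `|uτ| < 1`, `|vτ| = |ϖ|`; `h g h⁻¹ = c·γ₁`, `γ₁ = (a, b vτ; b, a + b uτ)` a unit of the Eisenstein order, `|b| = |ϖ|ⁿ`
    {uτ vτ : v.adicCompletion ↥(maximalRealSubfield L)} (hu : uτ ∈ 𝒪[v.adicCompletion ↥(maximalRealSubfield L)]) (hu1 : valuation (v.adicCompletion ↥(maximalRealSubfield L)) uτ < 1) (hv1 : valuation (v.adicCompletion ↥(maximalRealSubfield L)) vτ = valuation (v.adicCompletion ↥(maximalRealSubfield L)) ϖF)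
    {h γ₁ : GL (Fin 2) (v.adicCompletion ↥(maximalRealSubfield L))} {c a b : v.adicCompletion ↥(maximalRealSubfield L)} (hc : c ≠ 0)
    (hconj : ((h * g * h⁻¹ : GL (Fin 2) (v.adicCompletion ↥(maximalRealSubfield L))) : Matrix (Fin 2) (Fin 2) (v.adicCompletion ↥(maximalRealSubfield L))) = c • (γ₁ : Matrix (Fin 2) (Fin 2) (v.adicCompletion ↥(maximalRealSubfield L))))
    (hγ₁ : (γ₁ : Matrix (Fin 2) (Fin 2) (v.adicCompletion ↥(maximalRealSubfield L))) = !![a, b * vτ; b, a + b * uτ]) (ha : a ∈ 𝒪[v.adicCompletion ↥(maximalRealSubfield L)]) (hb : b ∈ 𝒪[v.adicCompletion ↥(maximalRealSubfield L)])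
    (hγ₁det : valuation (v.adicCompletion ↥(maximalRealSubfield L)) (γ₁ : Matrix (Fin 2) (Fin 2) (v.adicCompletion ↥(maximalRealSubfield L))).det = 1) {n : ℕ} (hbn : valuation (v.adicCompletion ↥(maximalRealSubfield L)) b = valuation (v.adicCompletion ↥(maximalRealSubfield L)) ϖF ^ n)
    (v₀ : {M : Submodule 𝒪[v.adicCompletion ↥(maximalRealSubfield L)] (Fin 2 → v.adicCompletion ↥(maximalRealSubfield L)) // IsSpecialLattice (RingHom.id _) ϖF !![(0 : v.adicCompletion ↥(maximalRealSubfield L)), 1; -1, 0] M}) (hv₀ : v₀.1 = latt (1 : Matrix (Fin 2) (Fin 2) (v.adicCompletion ↥(maximalRealSubfield L)))) :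
    ∃ N : ℕ, stableOrbitalIntegralRel (IsLocalStablyConjH L v) mH (hFamily L w hw (ϖ : w.1.adicCompletion L) 1) γH = (νH.real ((Ksh.prod (⊤ : Subgroup ((cmDatum L 1 (Matrix.of fun i j : Fin 1 => if i.val + j.val + 1 = 1 then (1 : L) else 0)).Local v)) : Subgroup ((cmDatum L 2 (Matrix.of fun i j : Fin 2 => if i.val + j.val + 1 = 2 then (1 : L) else 0)).Local v × (cmDatum L 1 (Matrix.of fun i j : Fin 1 => if i.val + j.val + 1 = 1 then (1 : L) else 0)).Local v)) : Set ((cmDatum L 2 (Matrix.of fun i j : Fin 2 => if i.val + j.val + 1 = 2 then (1 : L) else 0)).Local v × (cmDatum L 1 (Matrix.of fun i j : Fin 1 => if i.val + j.val + 1 = 1 then (1 : L) else 0)).Local v)) : ℂ) * (2 * (N : ℂ)) ∧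
      (Nat.card (IsLocalRing.ResidueField 𝒪[v.adicCompletion ↥(maximalRealSubfield L)]) - 1) * (N + 1) + 2 = 2 * Nat.card (IsLocalRing.ResidueField 𝒪[v.adicCompletion ↥(maximalRealSubfield L)]) ^ (n + 1) := by
  haveI : IsDiscreteValuationRing 𝒪[v.adicCompletion ↥(maximalRealSubfield L)] := isDiscreteValuationRing_integer_of_compatible hϖF
  refine ⟨_, stableOrbitalIntegralRel_hFamily_one_typeOne L v w hw νH he ϖ Ksh hKsh hKo hKc hmH hreg hsplit hell, ?_⟩
  rw [natCard_fixedBy_modular_eq_ncard_fixedEdges_of_v_eq_one L v w hw hα hα0 hϖF he hvα ϖ hϖ Ksh hKsh γH.1 hs hsg]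
  exact pred_card_mul_ncard_fixedEdges_succ_add_two_of_eisenstein_torusForm (isUniformizingElement_of_v_eq hϖF) hu hu1 hv1 hc hconj hγ₁ ha hb hγ₁det hbn v₀ hv₀

/-! ## §2 √π-TYPE PLACES (`α` an anti-fixed UNIFORMISER — tame, or wild with `d` odd): `K₂` ↔ set-wise fixed edges, `K♯` ↔ fixed vertices -/

include hw hα hα0 hϖF in
/-- **(b′) H-SIDE, `s = 0`, √π-TYPE PLACE, TYPE (1)**: `Φ^st(γ_H, hFamily 0) = ν_H(K₂ × U₁)·2N` with **`(q − 1)·(N + 1) + 2 = 2·q^{n+1}`** — `K₂` ↔ set-wise fixed EDGES at a √π place (★ p855331) + ★ `SLTwoTreeFixedSubtreeCount` §2; ★ (b′-4).  No `|2|_w = 1`. [cite: Rogawski1990, §4.9 Prop. 4.9.1 (b) p. 55, Lemma 4.9.3 p. 56; §3.6 pp. 31–32] [cite: Kottwitz1988, §2] [cite: LabesseLanglands1979, §2 p. 8] [cite: Tits1979, §3.2 p. 50] [cite: Serre1979, Ch. I §6] -/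
theorem exists_hFamily_zero_eq_mul_two_mul_and_law_of_v_eq_exp_neg_one (he : v.asIdeal.ramificationIdx' w.1.asIdeal ≠ 1) (hvα : Valued.v α = exp (-1 : ℤ))
    (ϖ : w.1.adicCompletion L)
    {mH : OrbitalMeasureFamily ((cmDatum L 2 (Matrix.of fun i j : Fin 2 => if i.val + j.val + 1 = 2 then (1 : L) else 0)).Local v × (cmDatum L 1 (Matrix.of fun i j : Fin 1 => if i.val + j.val + 1 = 1 then (1 : L) else 0)).Local v)} (hmH : mH.IsCanonical (IsLocalGRegular L v) νH)
    {γH : ((cmDatum L 2 (Matrix.of fun i j : Fin 2 => if i.val + j.val + 1 = 2 then (1 : L) else 0)).Local v × (cmDatum L 1 (Matrix.of fun i j : Fin 1 => if i.val + j.val + 1 = 1 then (1 : L) else 0)).Local v)} (hreg : IsLocalGRegular L v γH)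
    (hsplit : ∃ x : (w.1.adicCompletion L), ((((γH.1.val : GL (Fin 2) (UnitaryGroup.LocalRing L v)).val.map (Pi.evalRingHom (fun w' : PlacesOver L v => w'.1.adicCompletion L) w))).charpoly).IsRoot x)
    (hell : ¬ ∃ (y : ((cmDatum L 2 (Matrix.of fun i j : Fin 2 => if i.val + j.val + 1 = 2 then (1 : L) else 0)).Local v × (cmDatum L 1 (Matrix.of fun i j : Fin 1 => if i.val + j.val + 1 = 1 then (1 : L) else 0)).Local v)) (d' : Fin 2 → (UnitaryGroup.LocalRing L v)ˣ),
        glDiagonal 2 (UnitaryGroup.LocalRing L v) d' = ((y * γH * y⁻¹).1.val : GL (Fin 2) (UnitaryGroup.LocalRing L v)))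
    -- the descent representative `g ∈ GL₂(L⁺_v)` of `E₂ γ₂` (★ `exists_descent_of_antiFixed`)
    {s : w.1.adicCompletion L} {g : GL (Fin 2) (v.adicCompletion ↥(maximalRealSubfield L))} (hs : s ≠ 0)
    (hsg : Matrix.diagonal ![1, α] * ((((localNonsplitEquiv (IsCMField.complexConj L) (Matrix.of fun i j : Fin 2 => if i.val + j.val + 1 = 2 then (1 : L) else 0) (IsCMField.complexConj_ne_one L) w hw) γH.1 : ↥(unitaryGroupOfForm (galAdicCompletionMap (L := L) (IsCMField.complexConj L) hw) (placeForm (Matrix.of fun i j : Fin 2 => if i.val + j.val + 1 = 2 then (1 : L) else 0) w.1))) : GL (Fin 2) (w.1.adicCompletion L)) : Matrix (Fin 2) (Fin 2) (w.1.adicCompletion L)) * Matrix.diagonal ![1, α⁻¹] =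
      s • (g : Matrix (Fin 2) (Fin 2) (v.adicCompletion ↥(maximalRealSubfield L))).map (toPlace v w))
    -- the EISENSTEIN torus datum of `g`: `|uτ| < 1`, `|vτ| = |ϖ|`; `h g h⁻¹ = c·γ₁`, `γ₁ = (a, b vτ; b, a + b uτ)` a unit of the Eisenstein order, `|b| = |ϖ|ⁿ`
    {uτ vτ : v.adicCompletion ↥(maximalRealSubfield L)} (hu : uτ ∈ 𝒪[v.adicCompletion ↥(maximalRealSubfield L)]) (hu1 : valuation (v.adicCompletion ↥(maximalRealSubfield L)) uτ < 1) (hv1 : valuation (v.adicCompletion ↥(maximalRealSubfield L)) vτ = valuation (v.adicCompletion ↥(maximalRealSubfield L)) ϖF)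
    {h γ₁ : GL (Fin 2) (v.adicCompletion ↥(maximalRealSubfield L))} {c a b : v.adicCompletion ↥(maximalRealSubfield L)} (hc : c ≠ 0)
    (hconj : ((h * g * h⁻¹ : GL (Fin 2) (v.adicCompletion ↥(maximalRealSubfield L))) : Matrix (Fin 2) (Fin 2) (v.adicCompletion ↥(maximalRealSubfield L))) = c • (γ₁ : Matrix (Fin 2) (Fin 2) (v.adicCompletion ↥(maximalRealSubfield L))))
    (hγ₁ : (γ₁ : Matrix (Fin 2) (Fin 2) (v.adicCompletion ↥(maximalRealSubfield L))) = !![a, b * vτ; b, a + b * uτ]) (ha : a ∈ 𝒪[v.adicCompletion ↥(maximalRealSubfield L)]) (hb : b ∈ 𝒪[v.adicCompletion ↥(maximalRealSubfield L)])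
    (hγ₁det : valuation (v.adicCompletion ↥(maximalRealSubfield L)) (γ₁ : Matrix (Fin 2) (Fin 2) (v.adicCompletion ↥(maximalRealSubfield L))).det = 1) {n : ℕ} (hbn : valuation (v.adicCompletion ↥(maximalRealSubfield L)) b = valuation (v.adicCompletion ↥(maximalRealSubfield L)) ϖF ^ n)
    (v₀ : {M : Submodule 𝒪[v.adicCompletion ↥(maximalRealSubfield L)] (Fin 2 → v.adicCompletion ↥(maximalRealSubfield L)) // IsSpecialLattice (RingHom.id _) ϖF !![(0 : v.adicCompletion ↥(maximalRealSubfield L)), 1; -1, 0] M}) (hv₀ : v₀.1 = latt (1 : Matrix (Fin 2) (Fin 2) (v.adicCompletion ↥(maximalRealSubfield L)))) :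
    ∃ N : ℕ, stableOrbitalIntegralRel (IsLocalStablyConjH L v) mH (hFamily L w hw ϖ 0) γH = (νH.real (((cmLocalIntegralLevel L 2 (Matrix.of fun i j : Fin 2 => if i.val + j.val + 1 = 2 then (1 : L) else 0) v).prod (⊤ : Subgroup ((cmDatum L 1 (Matrix.of fun i j : Fin 1 => if i.val + j.val + 1 = 1 then (1 : L) else 0)).Local v)) : Subgroup ((cmDatum L 2 (Matrix.of fun i j : Fin 2 => if i.val + j.val + 1 = 2 then (1 : L) else 0)).Local v × (cmDatum L 1 (Matrix.of fun i j : Fin 1 => if i.val + j.val + 1 = 1 then (1 : L) else 0)).Local v)) : Set ((cmDatum L 2 (Matrix.of fun i j : Fin 2 => if i.val + j.val + 1 = 2 then (1 : L) else 0)).Local v × (cmDatum L 1 (Matrix.of fun i j : Fin 1 => if i.val + j.val + 1 = 1 then (1 : L) else 0)).Local v)) : ℂ) * (2 * (N : ℂ)) ∧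
      (Nat.card (IsLocalRing.ResidueField 𝒪[v.adicCompletion ↥(maximalRealSubfield L)]) - 1) * (N + 1) + 2 = 2 * Nat.card (IsLocalRing.ResidueField 𝒪[v.adicCompletion ↥(maximalRealSubfield L)]) ^ (n + 1) := by
  haveI : IsDiscreteValuationRing 𝒪[v.adicCompletion ↥(maximalRealSubfield L)] := isDiscreteValuationRing_integer_of_compatible hϖF
  refine ⟨_, stableOrbitalIntegralRel_hFamily_zero_typeOne L v w hw νH he ϖ hmH hreg hsplit hell, ?_⟩
  rw [natCard_fixedBy_cmLocalIntegralLevel_eq_ncard_fixedEdges_of_v_eq_exp_neg_one L v w hw hα hα0 hϖF he hvα γH.1 hs hsg]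
  exact pred_card_mul_ncard_fixedEdges_succ_add_two_of_eisenstein_torusForm (isUniformizingElement_of_v_eq hϖF) hu hu1 hv1 hc hconj hγ₁ ha hb hγ₁det hbn v₀ hv₀

include hw hα hα0 hϖF in
/-- **(b′) H-SIDE, `s = 1`, √π-TYPE PLACE, TYPE (1)**: for `K♯ ≤ U₂` matched with `D_ϖ GL₂(𝒪_w) D_ϖ⁻¹`, `Φ^st(γ_H, hFamily 1) = ν_H(K♯ × U₁)·2N` with **`(q − 1)·N + 2 = 2·q^{n+1}`** — `K♯` ↔ fixed VERTICES at a √π place (★ p847070 §1 `ncard_fixedBy_quotient_comap_modular_eq_ncard_setOf_glVertexAct` + ★ `natCard_fixedBy_eq_ncard_fixedBy_onePlace`) + ★ p855257; ★ (b′-4). [cite: Rogawski1990, §4.9 Prop. 4.9.1 (b) p. 55, Lemma 4.9.3 p. 56; §3.6 pp. 31–32] [cite: Kottwitz1988, §2] [cite: LabesseLanglands1979, §2 p. 8] [cite: Tits1979, §3.2 p. 50] [cite: Serre1979, Ch. I §6] -/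
theorem exists_hFamily_one_eq_mul_two_mul_and_law_of_v_eq_exp_neg_one (he : v.asIdeal.ramificationIdx' w.1.asIdeal ≠ 1) (hvα : Valued.v α = exp (-1 : ℤ))
    (ϖ : (w.1.adicCompletion L)ˣ) (hϖ : Valued.v (ϖ : w.1.adicCompletion L) = exp (-1 : ℤ))
    (Ksh : Subgroup ((cmDatum L 2 (Matrix.of fun i j : Fin 2 => if i.val + j.val + 1 = 2 then (1 : L) else 0)).Local v)) (hKsh : ∀ g', g' ∈ Ksh ↔ (((localNonsplitEquiv (IsCMField.complexConj L) (Matrix.of fun i j : Fin 2 => if i.val + j.val + 1 = 2 then (1 : L) else 0) (IsCMField.complexConj_ne_one L) w hw) g' : ↥(unitaryGroupOfForm (galAdicCompletionMap (L := L) (IsCMField.complexConj L) hw) (placeForm (Matrix.of fun i j : Fin 2 => if i.val + j.val + 1 = 2 then (1 : L) else 0) w.1))) : GL (Fin 2) (w.1.adicCompletion L)) ∈ (glInt 2 (w.1.adicCompletion L)).map (MulAut.conj (glDiagonal 2 (w.1.adicCompletion L) ![1, ϖ])).toMonoidHom)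
    (hKo : IsOpen (Ksh : Set ((cmDatum L 2 (Matrix.of fun i j : Fin 2 => if i.val + j.val + 1 = 2 then (1 : L) else 0)).Local v))) (hKc : IsCompact (Ksh : Set ((cmDatum L 2 (Matrix.of fun i j : Fin 2 => if i.val + j.val + 1 = 2 then (1 : L) else 0)).Local v)))
    {mH : OrbitalMeasureFamily ((cmDatum L 2 (Matrix.of fun i j : Fin 2 => if i.val + j.val + 1 = 2 then (1 : L) else 0)).Local v × (cmDatum L 1 (Matrix.of fun i j : Fin 1 => if i.val + j.val + 1 = 1 then (1 : L) else 0)).Local v)} (hmH : mH.IsCanonical (IsLocalGRegular L v) νH)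
    {γH : ((cmDatum L 2 (Matrix.of fun i j : Fin 2 => if i.val + j.val + 1 = 2 then (1 : L) else 0)).Local v × (cmDatum L 1 (Matrix.of fun i j : Fin 1 => if i.val + j.val + 1 = 1 then (1 : L) else 0)).Local v)} (hreg : IsLocalGRegular L v γH)
    (hsplit : ∃ x : (w.1.adicCompletion L), ((((γH.1.val : GL (Fin 2) (UnitaryGroup.LocalRing L v)).val.map (Pi.evalRingHom (fun w' : PlacesOver L v => w'.1.adicCompletion L) w))).charpoly).IsRoot x)
    (hell : ¬ ∃ (y : ((cmDatum L 2 (Matrix.of fun i j : Fin 2 => if i.val + j.val + 1 = 2 then (1 : L) else 0)).Local v × (cmDatum L 1 (Matrix.of fun i j : Fin 1 => if i.val + j.val + 1 = 1 then (1 : L) else 0)).Local v)) (d' : Fin 2 → (UnitaryGroup.LocalRing L v)ˣ),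
        glDiagonal 2 (UnitaryGroup.LocalRing L v) d' = ((y * γH * y⁻¹).1.val : GL (Fin 2) (UnitaryGroup.LocalRing L v)))
    -- the descent representative `g ∈ GL₂(L⁺_v)` of `E₂ γ₂` (★ `exists_descent_of_antiFixed`)
    {s : w.1.adicCompletion L} {g : GL (Fin 2) (v.adicCompletion ↥(maximalRealSubfield L))} (hs : s ≠ 0)
    (hsg : Matrix.diagonal ![1, α] * ((((localNonsplitEquiv (IsCMField.complexConj L) (Matrix.of fun i j : Fin 2 => if i.val + j.val + 1 = 2 then (1 : L) else 0) (IsCMField.complexConj_ne_one L) w hw) γH.1 : ↥(unitaryGroupOfForm (galAdicCompletionMap (L := L) (IsCMField.complexConj L) hw) (placeForm (Matrix.of fun i j : Fin 2 => if i.val + j.val + 1 = 2 then (1 : L) else 0) w.1))) : GL (Fin 2) (w.1.adicCompletion L)) : Matrix (Fin 2) (Fin 2) (w.1.adicCompletion L)) * Matrix.diagonal ![1, α⁻¹] =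
      s • (g : Matrix (Fin 2) (Fin 2) (v.adicCompletion ↥(maximalRealSubfield L))).map (toPlace v w))
    -- the EISENSTEIN torus datum of `g`: `|uτ| < 1`, `|vτ| = |ϖ|`; `h g h⁻¹ = c·γ₁`, `γ₁ = (a, b vτ; b, a + b uτ)` a unit of the Eisenstein order, `|b| = |ϖ|ⁿ`
    {uτ vτ : v.adicCompletion ↥(maximalRealSubfield L)} (hu : uτ ∈ 𝒪[v.adicCompletion ↥(maximalRealSubfield L)]) (hu1 : valuation (v.adicCompletion ↥(maximalRealSubfield L)) uτ < 1) (hv1 : valuation (v.adicCompletion ↥(maximalRealSubfield L)) vτ = valuation (v.adicCompletion ↥(maximalRealSubfield L)) ϖF)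
    {h γ₁ : GL (Fin 2) (v.adicCompletion ↥(maximalRealSubfield L))} {c a b : v.adicCompletion ↥(maximalRealSubfield L)} (hc : c ≠ 0)
    (hconj : ((h * g * h⁻¹ : GL (Fin 2) (v.adicCompletion ↥(maximalRealSubfield L))) : Matrix (Fin 2) (Fin 2) (v.adicCompletion ↥(maximalRealSubfield L))) = c • (γ₁ : Matrix (Fin 2) (Fin 2) (v.adicCompletion ↥(maximalRealSubfield L))))
    (hγ₁ : (γ₁ : Matrix (Fin 2) (Fin 2) (v.adicCompletion ↥(maximalRealSubfield L))) = !![a, b * vτ; b, a + b * uτ]) (ha : a ∈ 𝒪[v.adicCompletion ↥(maximalRealSubfield L)]) (hb : b ∈ 𝒪[v.adicCompletion ↥(maximalRealSubfield L)])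
    (hγ₁det : valuation (v.adicCompletion ↥(maximalRealSubfield L)) (γ₁ : Matrix (Fin 2) (Fin 2) (v.adicCompletion ↥(maximalRealSubfield L))).det = 1) {n : ℕ} (hbn : valuation (v.adicCompletion ↥(maximalRealSubfield L)) b = valuation (v.adicCompletion ↥(maximalRealSubfield L)) ϖF ^ n)
    (v₀ : {M : Submodule 𝒪[v.adicCompletion ↥(maximalRealSubfield L)] (Fin 2 → v.adicCompletion ↥(maximalRealSubfield L)) // IsSpecialLattice (RingHom.id _) ϖF !![(0 : v.adicCompletion ↥(maximalRealSubfield L)), 1; -1, 0] M}) (hv₀ : v₀.1 = latt (1 : Matrix (Fin 2) (Fin 2) (v.adicCompletion ↥(maximalRealSubfield L)))) :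
    ∃ N : ℕ, stableOrbitalIntegralRel (IsLocalStablyConjH L v) mH (hFamily L w hw (ϖ : w.1.adicCompletion L) 1) γH = (νH.real ((Ksh.prod (⊤ : Subgroup ((cmDatum L 1 (Matrix.of fun i j : Fin 1 => if i.val + j.val + 1 = 1 then (1 : L) else 0)).Local v)) : Subgroup ((cmDatum L 2 (Matrix.of fun i j : Fin 2 => if i.val + j.val + 1 = 2 then (1 : L) else 0)).Local v × (cmDatum L 1 (Matrix.of fun i j : Fin 1 => if i.val + j.val + 1 = 1 then (1 : L) else 0)).Local v)) : Set ((cmDatum L 2 (Matrix.of fun i j : Fin 2 => if i.val + j.val + 1 = 2 then (1 : L) else 0)).Local v × (cmDatum L 1 (Matrix.of fun i j : Fin 1 => if i.val + j.val + 1 = 1 then (1 : L) else 0)).Local v)) : ℂ) * (2 * (N : ℂ)) ∧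
      (Nat.card (IsLocalRing.ResidueField 𝒪[v.adicCompletion ↥(maximalRealSubfield L)]) - 1) * N + 2 = 2 * Nat.card (IsLocalRing.ResidueField 𝒪[v.adicCompletion ↥(maximalRealSubfield L)]) ^ (n + 1) := by
  haveI : IsDiscreteValuationRing 𝒪[v.adicCompletion ↥(maximalRealSubfield L)] := isDiscreteValuationRing_integer_of_compatible hϖF
  refine ⟨_, stableOrbitalIntegralRel_hFamily_one_typeOne L v w hw νH he ϖ Ksh hKsh hKo hKc hmH hreg hsplit hell, ?_⟩
  rw [natCard_fixedBy_eq_ncard_fixedBy_onePlace L v w hw ϖ Ksh hKsh γH.1,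
    ncard_fixedBy_quotient_comap_modular_eq_ncard_setOf_glVertexAct L v w hw hα hα0 hϖF he hvα ϖ hϖ _ hs hsg]
  exact ncard_setOf_glVertexAct_eq_self_of_eisenstein_torusForm (isUniformizingElement_of_v_eq hϖF) hu hu1 hv1 hc hconj hγ₁ ha hb hγ₁det hbn v₀ hv₀

end Place

end Summit.HodgeConjecture.HodgeConjecture.Cruxes.H413.F0P3cDyRamHSideTypeOneTorusForm

end
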